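import Summits.ResolutionOfSingularities.ResolutionOfSingularities.Theorems.PurelyInseparableDim4JointForestFinitePlanKitMembers
import HarnessLib

/-!
# Purely inseparable four-folds: the finite-plan certificate kit with POINT-TREE LEAVES (brick S3 (c) «joint point∘coordinate
# chains», part 28c, cell `res-dim4-pi`)

[OURS · counted 0] (D-0157 DOOR 2; desk WORD #66 (4)(c), #74 (g), #99 (d); frame `PIDim4.TerminationImpliesOrderReduction`,
S3 (c); host item stmt-ResolutionOfSingularities-16155, helper). Nothing here proves resolution of singularities in
dimension ≥ 4 / characteristic `p` — NOT here, not anywhere in this programme.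

Parts 28 / 28b ask every LEAF state to be DEAD at once (no equimultiple pair for the point centre). Here a leaf may carry a finite
POINT TREE instead (typ-3 g2's tree certificates, `PointTreeWitness` p672664, in list form): a finite set `R` of states containing
every leaf state, a rule `pp` listing the equimultiple pairs `(k, c)` (`c_k = 0`) of each state of `R` — COVERING them all — closed
under the point steps and ranked by a strictly decreasing `rkR`. Dead leaves are the case `pp = ∅`.

* `acc_edge_of_pointplan`, `mem_of_reflTransGen_edge_of_pointplan`, `finite_pairs_of_pointplan` — the bookkeeping;
* **`exists_isMarkedResolution_finite_plan_cert_pointtrees`** — the kit (several separated members, any depth, point-tree leaves).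

AI-produced formalisation, weaker than expert review. bears_on: LADDER-RESOLUTION:D157-DOOR2 (res-dim4-pi · S3 (c) joint v2 · kit).
-/

set_option linter.dupNamespace false -- D-0017: single-problem summit path `Summit.<S>.<S>.…` by design

noncomputable section

open MvPolynomial Finset CategoryTheory AlgebraicGeometry Opposite TopologicalSpace

namespace Summit.ResolutionOfSingularities.ResolutionOfSingularities.Theorems.PIDim4

open Literature.AlgebraicGeometry.Resolution
open Literature.AlgebraicGeometry.Resolution.Hauser2010
open Literature.AlgebraicGeometry.Resolution.AffinePointBlowup (P A γ coord Wtop ξ)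

namespace Equimultiple

/-! ## §1 Point plans: finite point trees below a leaf -/

section PointPlan

variable {K : Type} [Field K] {p : ℕ} [DecidableEq K]

/-- On a finite set `R` of states whose equimultiple pairs are listed by `pp` (cover), closed under the listed point steps and ranked by a
strictly decreasing `rkR`, the flipped edge relation of the point centre is accessible at every state of `R`. [folklore] -/
theorem acc_edge_of_pointplan (R : Finset (State K)) (pp : State K → Finset (Fin 4 × (Fin 4 → K)))
    (hRclosed : ∀ s ∈ R, ∀ kc ∈ pp s, CentreBlowup.step p Finset.univ kc.1 kc.2 s ∈ R) (rkR : State K → ℕ)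
    (hrkR : ∀ s ∈ R, ∀ kc ∈ pp s, rkR (CentreBlowup.step p Finset.univ kc.1 kc.2 s) < rkR s)
    (hppcover : ∀ s ∈ R, ∀ (k : Fin 4) (c : Fin 4 → K), c k = 0 →
      CentreBlowup.IsEquimultiplePoint p Finset.univ k c s → (k, c) ∈ pp s) :
    ∀ s ∈ R, Acc (fun s' s : State K => Edge p Finset.univ s s') s := by
  suffices h : ∀ (n : ℕ) (s : State K), s ∈ R → rkR s ≤ n → Acc (fun s' s : State K => Edge p Finset.univ s s') s from
    fun s hs => h (rkR s) s hs le_rfl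
  intro n
  induction n with
  | zero =>
    intro s hs hn
    refine Acc.intro _ fun s' ⟨k, c, _, hck, heq, _, _⟩ => ?_
    have hlt : rkR (CentreBlowup.step p Finset.univ k c s) < rkR s := hrkR s hs (k, c) (hppcover s hs k c hck heq)
    omega
  | succ n ih =>
    intro s hs hn
    refine Acc.intro _ fun s' ⟨k, c, _, hck, heq, _, hs'⟩ => ?_
    have hkc := hppcover s hs k c hck heq
    have hlt : rkR (CentreBlowup.step p Finset.univ k c s) < rkR s := hrkR s hs (k, c) hkc
    subst hs'
    exact ih _ (hRclosed s hs (k, c) hkc) (by omega)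

/-- … every state reachable by edges from a state of `R` lies in `R` … [folklore] -/
theorem mem_of_reflTransGen_edge_of_pointplan (R : Finset (State K)) (pp : State K → Finset (Fin 4 × (Fin 4 → K)))
    (hRclosed : ∀ s ∈ R, ∀ kc ∈ pp s, CentreBlowup.step p Finset.univ kc.1 kc.2 s ∈ R)
    (hppcover : ∀ s ∈ R, ∀ (k : Fin 4) (c : Fin 4 → K), c k = 0 →
      CentreBlowup.IsEquimultiplePoint p Finset.univ k c s → (k, c) ∈ pp s)
    {s₀ s' : State K} (hs₀ : s₀ ∈ R) (hs' : Relation.ReflTransGen (fun a e : State K => Edge p Finset.univ a e) s₀ s') :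
    s' ∈ R := by
  induction hs' with
  | refl => exact hs₀
  | tail _ he ih =>
    obtain ⟨k, c, -, hck, heq, -, rfl⟩ := he
    exact hRclosed _ ih (k, c) (hppcover _ ih k c hck heq)

/-- … and carries finitely many equimultiple pairs (all listed by `pp`). [folklore] -/
theorem finite_pairs_of_pointplan (R : Finset (State K)) (pp : State K → Finset (Fin 4 × (Fin 4 → K)))
    (hRclosed : ∀ s ∈ R, ∀ kc ∈ pp s, CentreBlowup.step p Finset.univ kc.1 kc.2 s ∈ R)
    (hppcover : ∀ s ∈ R, ∀ (k : Fin 4) (c : Fin 4 → K), c k = 0 →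
      CentreBlowup.IsEquimultiplePoint p Finset.univ k c s → (k, c) ∈ pp s)
    {s₀ : State K} (hs₀ : s₀ ∈ R) (s' : State K)
    (hs' : Relation.ReflTransGen (fun a e : State K => Edge p Finset.univ a e) s₀ s') :
    {jb : Fin 4 × (Fin 4 → K) | jb.2 jb.1 = 0 ∧ CentreBlowup.IsEquimultiplePoint p Finset.univ jb.1 jb.2 s'}.Finite := by
  have hs'R := mem_of_reflTransGen_edge_of_pointplan R pp hRclosed hppcover hs₀ hs'
  refine (pp s').finite_toSet.subset ?_
  rintro ⟨k, c⟩ ⟨hck, heq⟩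
  exact hppcover s' hs'R k c hck heq

end PointPlan

/-! ## §2 The kit theorem -/

section Kit

variable {K : Type} [Field K] {p : ℕ} [hp : Fact p.Prime] [CharP K p]

/-- **FINITE-PLAN CERTIFICATE KIT WITH POINT-TREE LEAVES.** `K = K̄` of characteristic `p`, `F ≠ 0` clean; finitely many pairwise
SEPARATED members `(b, S)` (each `V(z, x_S)` permissible for the re-centred cleaned equation), together carrying every root parameter;
rules `plan` / `leaves`, a finite set `Q` of (state, centre) pairs containing every member's root pair, CLOSED under the child map and
RANKED by a strictly decreasing `rk`; at every pair of `Q` the per-node conditions of the forest (entries in the frame, pairwise separated,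
NORMALISED cover); and for the leaves a finite set `R` of states containing every leaf state, a rule `pp` COVERING the equimultiple pairs
of each state of `R`, closed under the point steps and ranked by a strictly decreasing `rkR` ⇒ `(𝔸⁵_K, (z^p + F)·𝒪, [], p)` admits a
marked resolution (BGMW Def. 3.1.3). [cite: BierstoneGrigorievMilmanWlodarczyk2011, Def. 3.1.3] [cite: HauserPerlega2019PRIMS, §2]
[cite: Hauser2010, §F (equiconstant points)] -/
theorem exists_isMarkedResolution_finite_plan_cert_pointtrees [IsAlgClosed K] [DecidableEq K] (F : MvPolynomial (Fin 4) K)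
    (hF : F ≠ 0) (hclean : Literature.Barriers.ResolutionOfSingularities.HauserPerlega.IsClean p F)
    (mem : Finset ((Fin 4 → K) × Finset (Fin 4)))
    (hmem : ∀ bS ∈ mem, IsPermissibleCentre p bS.2 (deletePthPowers p (PointBlowup.translate bS.1 F)))
    (hsep : ∀ bS ∈ mem, ∀ bS' ∈ mem, bS ≠ bS' → ∃ i ∈ bS.2, i ∈ bS'.2 ∧ bS.1 i ≠ bS'.1 i)
    (hroots : ∀ b' : Fin 4 → K, (∀ d : Fin 4 →₀ ℕ, d ≠ 0 → d.degree < p → coeff d (PointBlowup.translate b' F) = 0) →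
      ∃ bS ∈ mem, ∀ i ∈ bS.2, b' i = bS.1 i)
    (plan : State K → Finset (Fin 4) → Finset (Fin 4 × (Fin 4 → K) × Finset (Fin 4)))
    (leaves : State K → Finset (Fin 4) → Finset (Fin 4 × (Fin 4 → K)))
    (Q : Finset (State K × Finset (Fin 4)))
    (hq₀ : ∀ bS ∈ mem, ((⟨deletePthPowers p (PointBlowup.translate bS.1 F), 0, ∅⟩ : State K), bS.2) ∈ Q)
    (hclosed : ∀ q ∈ Q, ∀ e ∈ plan q.1 q.2, (CentreBlowup.step p q.2 e.1 e.2.1 q.1, e.2.2) ∈ Q)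
    (rk : State K × Finset (Fin 4) → ℕ)
    (hrk : ∀ q ∈ Q, ∀ e ∈ plan q.1 q.2, rk (CentreBlowup.step p q.2 e.1 e.2.1 q.1, e.2.2) < rk q)
    (hP1 : ∀ q ∈ Q, ∀ e ∈ plan q.1 q.2, e.1 ∈ q.2 ∧ e.2.1 e.1 = 0 ∧ q.2 ⊆ e.2.2 ∧
      CentreBlowup.IsEquimultiplePoint p q.2 e.1 e.2.1 q.1 ∧ IsPermissibleCentre p e.2.2 (CentreBlowup.step p q.2 e.1 e.2.1 q.1).F)
    (hP2 : ∀ q ∈ Q, ∀ e ∈ plan q.1 q.2, ∀ e' ∈ plan q.1 q.2, e ≠ e' →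
      (e.1 = e'.1 ∧ ∃ i ∈ e.2.2, i ∈ e'.2.2 ∧ e.2.1 i ≠ e'.2.1 i) ∨
      (e.1 ≠ e'.1 ∧ ((e'.2.1 e.1 = 0 ∧ e.1 ∈ e'.2.2) ∨ (e.2.1 e'.1 = 0 ∧ e'.1 ∈ e.2.2))))
    (hcover : ∀ q ∈ Q, ∀ (j' : Fin 4) (b' : Fin 4 → K), j' ∈ q.2 → b' j' = 0 → (∀ k ∈ q.2, k < j' → b' k = 0) →
      CentreBlowup.IsEquimultiplePoint p q.2 j' b' q.1 →
      (∃ e ∈ plan q.1 q.2, e.1 = j' ∧ ∀ i ∈ e.2.2, b' i = e.2.1 i) ∨ (j', b') ∈ leaves q.1 q.2)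
    (R : Finset (State K)) (hR₀ : ∀ q ∈ Q, ∀ l ∈ leaves q.1 q.2, CentreBlowup.step p q.2 l.1 l.2 q.1 ∈ R)
    (pp : State K → Finset (Fin 4 × (Fin 4 → K)))
    (hRclosed : ∀ s ∈ R, ∀ kc ∈ pp s, CentreBlowup.step p Finset.univ kc.1 kc.2 s ∈ R) (rkR : State K → ℕ)
    (hrkR : ∀ s ∈ R, ∀ kc ∈ pp s, rkR (CentreBlowup.step p Finset.univ kc.1 kc.2 s) < rkR s)
    (hppcover : ∀ s ∈ R, ∀ (k : Fin 4) (c : Fin 4 → K), c k = 0 →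
      CentreBlowup.IsEquimultiplePoint p Finset.univ k c s → (k, c) ∈ pp s) :
    ∃ (X' : Scheme.{0}) (ρ : X' ⟶ P 4 K) (M' : MarkedIdeal X'),
      IsMarkedResolution (⟨hypSheaf p F, [], p⟩ : MarkedIdeal (P 4 K)) ρ M' := by
  classical
  refine exists_isMarkedResolution_joint_forest_root_normalised F hF hclean plan leaves mem (fun bS hbS => ?_) hsep
    (Set.finite_empty.subset ?_) (fun b' H hoff => ?_)
  · refine ⟨hmem bS hbS, fun q hq => ?_, acc_plan_of_rank plan Q hclosed rk hrk _ (hq₀ bS hbS)⟩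
    have hqQ : q ∈ Q := mem_of_reflTransGen_plan plan Q hclosed (hq₀ bS hbS) hq
    exact ⟨hP1 q hqQ, hP2 q hqQ, fun l hl _ =>
      ⟨acc_edge_of_pointplan R pp hRclosed rkR hrkR hppcover _ (hR₀ q hqQ l hl),
        fun s' hs' => finite_pairs_of_pointplan R pp hRclosed hppcover (hR₀ q hqQ l hl) s' hs'⟩, hcover q hqQ⟩
  · rintro b' ⟨H, hoff'⟩
    obtain ⟨bS, hbS, hagree⟩ := hroots b' H
    exact hoff' bS hbS hagree
  · exfalso
    obtain ⟨bS, hbS, hagree⟩ := hroots b' H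
    exact hoff bS hbS hagree

end Kit

end Equimultiple

end Summit.ResolutionOfSingularities.ResolutionOfSingularities.Theorems.PIDim4

end
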